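import Mathlib.NumberTheory.DirichletCharacter.Orthogonality
import Mathlib.NumberTheory.GaussSum
import Mathlib.Analysis.SpecialFunctions.Complex.CircleAddChar
import Literature.NumberTheory.Sieve.MontgomeryVaughan1975Section6C
import HarnessLib

/-!
# Expansion of an additive character in Dirichlet characters; twisted orthogonality of Gauss sums

Trunk T-ANT (NumberTheory/GaussSums). Sources reproduced:

* H. L. Montgomery, R. C. Vaughan, *Multiplicative Number Theory I* (CUP 2007)
  [MontgomeryVaughan2007], §9.2, Theorem 9.5, eq. (9.6): "Suppose that χ is a character modulo q.
  If (n, q) = 1, then `χ(n)τ(χ̄) = ∑_{a=1}^{q} χ̄(a)e(an/q)`" (Mathlib: `gaussSum_mulShift`). Summing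
  (9.6) over all characters and using orthogonality gives the expansion of the additive character
  at a unit argument, `e(n/q) = φ(q)⁻¹ ∑_{χ mod q} τ(χ̄) χ(n)` — the device by which additive and
  multiplicative harmonics are exchanged (Bombieri's large sieve for characters; the dispersion
  method).
* Y. Zhang, *Discrete mean estimates and the Landau–Siegel zero*, arXiv:2211.02515v1 (2022)
  [Zhang2022LandauSiegel] — **an unrefereed manuscript, a claimed result under adjudication** — §7,
  proof of Proposition 7.1 (mean-value formula I), the two classical steps that open the
  off-diagonal analysis: "Since `τ(ψ⁰_p) = −1`, for `(kl,p) = 1` we have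
  `∑*_{ψ (mod p)} τ(ψ̄)ψ(l)ψ̄(k) = p e(l k̄/p) + O(1)` with `k̄k ≡ 1 (mod p)`", "by the relation
  `k̄/p ≡ −p̄/k + 1/(pk) (mod 1)` we have `e(l k̄/p)Δ₁(l/pk) = e(−l p̄/k)Δ(l/pk)`" and "For
  `(l,k) = 1` we have `e(−l p̄/k) = μ(k)/φ(k) + (1/φ(k)) Σ′_{θ (mod k)} τ(θ̄)θ(l)θ̄(−p)`" (the same
  steps open the proof of Proposition 14.1).

What is here (all PROVED; no definitions, no named facts; the additive character is Mathlib's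
`ZMod.stdAddChar`, `e(a/m) = stdAddChar a`, and `τ(ψ̄) = gaussSum ψ⁻¹ stdAddChar`):
`gaussSum_inv_mul_apply_eq_sum` (MV (9.6)); `sum_inv_apply_eq_ite` (orthogonality,
`∑_ψ ψ̄(b) = φ(m)[b = 1]`); `sum_gaussSum_inv_mul_apply` (`∑_ψ τ(ψ̄)ψ(a) = φ(m) e(a/m)`, `a` a unit)
and the two-argument form `sum_gaussSum_inv_mul_apply_mul_inv_apply`
(`∑_ψ τ(ψ̄)ψ(l)ψ̄(k) = φ(m) e(l k̄/m)`); for a prime modulus, where the primitive characters are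
the non-principal ones and `τ(ψ₀) = −1` (`gaussSum_one_stdAddChar`, Mathlib's
`gaussSum_one_left`), Zhang's display in EXACT form
`∑_{ψ ≠ ψ₀} τ(ψ̄)ψ(l)ψ̄(k) = (p − 1) e(l k̄/p) + 1` (`sum_nontrivial_gaussSum_inv_mul_apply_mul_inv_apply`)
with the `O(1)` made explicit, `|∑* − p e(l k̄/p)| ≤ 2` (`norm_sum_nontrivial_sub_le`); and the
reciprocity for modular inverses `k k̄ + p p̄ ≡ 1 (mod pk)` (`mul_inv_add_mul_inv_modEq_one`) with
its exponential form `e(l k̄/p) = e(−l p̄/k) e(l/(pk))` (`exp_mul_inv_div_eq`); and, for a general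
modulus `k`, Zhang's third display `e(−l p̄/k) = μ(k)/φ(k) + φ(k)⁻¹ Σ′_{θ mod k} τ(θ̄)θ(l)θ̄(−p)`
(`stdAddChar_neg_mul_inv_eq`), the expansion with the principal term `τ(θ̄₀) = μ(k)` split off
(the tree's `Literature.NumberTheory.Sieve.MontgomeryVaughan1975.gaussSum_one_inv_eq_moebius`).

Why this is formalised (Landau–Siegel autopsy, `run/shared/lean/pub/pub-zhang`, STEPS rows X7.x /
M2): these are the classical inputs of the "dispersion-type manoeuvre" by which Propositions 7.1
and 14.1 of the source reach their main terms (orthogonality mod `p` ⇒ `p e(l k̄/p) + O(1)`;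
reciprocity; expansion of `e(−l p̄/k)` into characters `θ mod k`). They are correct as printed;
this file makes them kernel-checked. The located failure of the source ((8.24)) is downstream and
numerical. No statement about Theorems 1–2 of the source is made or implied.
-/

noncomputable section

open Finset Complex

namespace Literature.NumberTheory.GaussSums

variable {m : ℕ} [NeZero m]

/-- `τ(ψ̄) ψ(a) = ∑_{b mod m} ψ̄(b) e(ab/m)` for a unit `a` (Mathlib's `gaussSum_mulShift`,
rearranged; `ψ̄ = ψ⁻¹`). [cite: MontgomeryVaughan2007, §9.2, Theorem 9.5, (9.6)] -/
theorem gaussSum_inv_mul_apply_eq_sum (ψ : DirichletCharacter ℂ m) (a : (ZMod m)ˣ) :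
    gaussSum ψ⁻¹ (ZMod.stdAddChar (N := m)) * ψ a =
      ∑ b : ZMod m, ψ⁻¹ b * ZMod.stdAddChar ((a : ZMod m) * b) := by
  have h := gaussSum_mulShift ψ⁻¹ (ZMod.stdAddChar (N := m)) a
  have hψa : ψ (a : ZMod m) ≠ 0 := by
    rw [← MulChar.coe_toUnitHom]; exact Units.ne_zero _
  have hinv : ψ⁻¹ (a : ZMod m) * ψ a = 1 := by
    rw [MulChar.inv_apply_eq_inv']; exact inv_mul_cancel₀ hψa
  calc gaussSum ψ⁻¹ (ZMod.stdAddChar (N := m)) * ψ a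
      = (ψ⁻¹ (a : ZMod m) * ψ a) * gaussSum ψ⁻¹ ((ZMod.stdAddChar (N := m)).mulShift a) := by
        rw [← h]; ring
    _ = ∑ b : ZMod m, ψ⁻¹ b * ZMod.stdAddChar ((a : ZMod m) * b) := by
        rw [hinv, one_mul, gaussSum]
        exact sum_congr rfl fun b _ => by rw [AddChar.mulShift_apply]

/-- Orthogonality in the form `∑_ψ ψ̄(b) = φ(m)·[b = 1]`. [folklore] -/
theorem sum_inv_apply_eq_ite (b : ZMod m) :
    ∑ ψ : DirichletCharacter ℂ m, ψ⁻¹ b = if b = 1 then (m.totient : ℂ) else 0 := by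
  by_cases hb : IsUnit b
  · have h := DirichletCharacter.sum_char_inv_mul_char_eq (R := ℂ) hb 1
    simp only [map_one, mul_one] at h
    rw [← h]
    refine sum_congr rfl fun ψ _ => ?_
    rw [MulChar.inv_apply ψ b, Ring.inverse_of_isUnit hb]
    obtain ⟨u, rfl⟩ := hb
    simp
  · have hb1 : b ≠ 1 := fun h => hb (h ▸ isUnit_one)
    rw [if_neg hb1]
    exact sum_eq_zero fun ψ _ => MulChar.map_nonunit _ hb

/-- **Expansion of the additive character in Dirichlet characters** (sum MV (9.6) over `χ`; the
device behind Bombieri's large sieve for characters and the opening step of the dispersion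
method): for a unit `a mod m`, `∑_{ψ mod m} τ(ψ̄) ψ(a) = φ(m) e(a/m)`, i.e.
`e(a/m) = φ(m)⁻¹ ∑_ψ τ(ψ̄) ψ(a)`. [folklore] -/
theorem sum_gaussSum_inv_mul_apply (a : (ZMod m)ˣ) :
    ∑ ψ : DirichletCharacter ℂ m, gaussSum ψ⁻¹ (ZMod.stdAddChar (N := m)) * ψ a =
      (m.totient : ℂ) * ZMod.stdAddChar (a : ZMod m) := by
  simp_rw [gaussSum_inv_mul_apply_eq_sum]
  rw [sum_comm]
  simp_rw [← sum_mul, sum_inv_apply_eq_ite, ite_mul, zero_mul]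
  rw [sum_ite_eq' univ (1 : ZMod m) (fun b => (m.totient : ℂ) * ZMod.stdAddChar ((a : ZMod m) * b))]
  simp

/-- The same with two unit arguments: `∑_{ψ mod m} τ(ψ̄) ψ(l) ψ̄(k) = φ(m) e(l k̄/m)`,
`k̄ k ≡ 1 (mod m)`. [folklore] -/
theorem sum_gaussSum_inv_mul_apply_mul_inv_apply (l k : (ZMod m)ˣ) :
    ∑ ψ : DirichletCharacter ℂ m, gaussSum ψ⁻¹ (ZMod.stdAddChar (N := m)) * ψ l * ψ⁻¹ k =
      (m.totient : ℂ) * ZMod.stdAddChar ((l : ZMod m) * ((k⁻¹ : (ZMod m)ˣ) : ZMod m)) := by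
  rw [← Units.val_mul, ← sum_gaussSum_inv_mul_apply (l * k⁻¹)]
  refine sum_congr rfl fun ψ _ => ?_
  rw [Units.val_mul, map_mul, MulChar.inv_apply ψ (k : ZMod m), Ring.inverse_unit, mul_assoc]

/-! ### Prime modulus: the form used in Zhang (2022), §7 -/

section Prime

variable {p : ℕ} [Fact p.Prime]

/-- For a prime `p` the standard additive character of `ℤ/p` is non-trivial. [folklore] -/
theorem stdAddChar_ne_one : (ZMod.stdAddChar (N := p)) ≠ 1 := by
  have h := ZMod.isPrimitive_stdAddChar p (one_ne_zero)
  rwa [AddChar.mulShift_one] at h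

/-- `τ(ψ₀) = -1` for the principal character modulo a prime (Mathlib's `gaussSum_one_left`).
[folklore] -/
theorem gaussSum_one_stdAddChar :
    gaussSum (1 : DirichletCharacter ℂ p) (ZMod.stdAddChar (N := p)) = -1 :=
  gaussSum_one_left stdAddChar_ne_one

/-- **Zhang's display, exact form** [cite: Zhang2022LandauSiegel, §7, proof of Proposition 7.1,
display after "Since τ(ψ⁰_p) = −1"] ("for `(kl,p) = 1` we have
`∑*_{ψ (mod p)} τ(ψ̄)ψ(l)ψ̄(k) = p e(l k̄/p) + O(1)` with `k̄k ≡ 1 (mod p)`"; for a prime modulus the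
primitive characters are the non-principal ones): the sum over the NON-PRINCIPAL characters
modulo a prime `p` equals `(p − 1) e(l k̄/p) + 1 = p e(l k̄/p) + (1 − e(l k̄/p))`. -/
theorem sum_nontrivial_gaussSum_inv_mul_apply_mul_inv_apply [DecidableEq (DirichletCharacter ℂ p)]
    (l k : (ZMod p)ˣ) :
    ∑ ψ ∈ (univ : Finset (DirichletCharacter ℂ p)).erase 1,
        gaussSum ψ⁻¹ (ZMod.stdAddChar (N := p)) * ψ l * ψ⁻¹ k =
      ((p : ℂ) - 1) * ZMod.stdAddChar ((l : ZMod p) * ((k⁻¹ : (ZMod p)ˣ) : ZMod p)) + 1 := by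
  have htot : (p.totient : ℂ) = (p : ℂ) - 1 := by
    rw [Nat.totient_prime (Fact.out : p.Prime)]
    have : 1 ≤ p := (Fact.out : p.Prime).one_lt.le
    push_cast [Nat.cast_sub this]
    ring
  have h := sum_gaussSum_inv_mul_apply_mul_inv_apply (m := p) l k
  rw [← Finset.sum_erase_add _ _ (mem_univ (1 : DirichletCharacter ℂ p)), inv_one,
    gaussSum_one_stdAddChar, MulChar.one_apply_coe, MulChar.one_apply_coe, htot] at h
  linear_combination h

/-- The `O(1)` made explicit: `|∑*_{ψ mod p} τ(ψ̄)ψ(l)ψ̄(k) − p e(l k̄/p)| ≤ 2`.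
[cite: Zhang2022LandauSiegel, §7, proof of Proposition 7.1] -/
theorem norm_sum_nontrivial_sub_le [DecidableEq (DirichletCharacter ℂ p)] (l k : (ZMod p)ˣ) :
    ‖∑ ψ ∈ (univ : Finset (DirichletCharacter ℂ p)).erase 1,
        gaussSum ψ⁻¹ (ZMod.stdAddChar (N := p)) * ψ l * ψ⁻¹ k -
      (p : ℂ) * ZMod.stdAddChar ((l : ZMod p) * ((k⁻¹ : (ZMod p)ˣ) : ZMod p))‖ ≤ 2 := by
  rw [sum_nontrivial_gaussSum_inv_mul_apply_mul_inv_apply]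
  have h1 : ‖(ZMod.stdAddChar ((l : ZMod p) * ((k⁻¹ : (ZMod p)ˣ) : ZMod p)) : ℂ)‖ = 1 :=
    AddChar.norm_apply _ _
  calc ‖((p : ℂ) - 1) * ZMod.stdAddChar ((l : ZMod p) * ((k⁻¹ : (ZMod p)ˣ) : ZMod p)) + 1 -
        (p : ℂ) * ZMod.stdAddChar ((l : ZMod p) * ((k⁻¹ : (ZMod p)ˣ) : ZMod p))‖
      = ‖(1 : ℂ) - ZMod.stdAddChar ((l : ZMod p) * ((k⁻¹ : (ZMod p)ˣ) : ZMod p))‖ := by ring_nf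
    _ ≤ ‖(1 : ℂ)‖ + ‖(ZMod.stdAddChar ((l : ZMod p) * ((k⁻¹ : (ZMod p)ˣ) : ZMod p)) : ℂ)‖ := norm_sub_le _ _
    _ = 2 := by rw [h1, norm_one]; norm_num

end Prime

/-! ### Reciprocity for modular inverses -/

/-- **Reciprocity for modular inverses** [cite: Zhang2022LandauSiegel, §7, display
"k̄/p ≡ −p̄/k + 1/(pk) (mod 1)"]: if `(p, k) = 1`, `k k̄ ≡ 1 (mod p)` and `p p̄ ≡ 1 (mod k)`, then
`k k̄ + p p̄ ≡ 1 (mod pk)`, i.e. `k̄/p + p̄/k − 1/(pk) ∈ ℤ`. -/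
theorem mul_inv_add_mul_inv_modEq_one {p k kb pb : ℤ} (hpk : IsCoprime p k)
    (hk : k * kb ≡ 1 [ZMOD p]) (hp : p * pb ≡ 1 [ZMOD k]) :
    k * kb + p * pb ≡ 1 [ZMOD p * k] := by
  have h1 : k * kb + p * pb ≡ 1 [ZMOD p] := by
    have : p * pb ≡ 0 [ZMOD p] := Int.modEq_zero_iff_dvd.mpr (dvd_mul_right p pb)
    simpa using hk.add this
  have h2 : k * kb + p * pb ≡ 1 [ZMOD k] := by
    have : k * kb ≡ 0 [ZMOD k] := Int.modEq_zero_iff_dvd.mpr (dvd_mul_right k kb)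
    simpa using this.add hp
  have hpk' : p.natAbs.Coprime k.natAbs := by
    rw [Nat.Coprime, ← Int.gcd_eq_natAbs]
    exact Int.isCoprime_iff_gcd_eq_one.mp hpk
  exact (Int.modEq_and_modEq_iff_modEq_mul hpk').mp ⟨h1, h2⟩

/-- The exponential form used in Zhang's §7: with `e(x) = exp(2πix)`,
`e(l k̄/p) = e(−l p̄/k) · e(l/(pk))` for integers `l` and `p, k ≥ 1` coprime,
`k k̄ ≡ 1 (mod p)`, `p p̄ ≡ 1 (mod k)`. [cite: Zhang2022LandauSiegel, §7, display
"e(l k̄/p)Δ₁(l/pk) = e(−l p̄/k)Δ(l/pk)" (the exponential factor)] -/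
theorem exp_mul_inv_div_eq {p k kb pb : ℤ} (l : ℤ) (hp0 : p ≠ 0) (hk0 : k ≠ 0)
    (hpk : IsCoprime p k) (hk : k * kb ≡ 1 [ZMOD p]) (hp : p * pb ≡ 1 [ZMOD k]) :
    Complex.exp (2 * Real.pi * I * (l * kb / p)) =
      Complex.exp (2 * Real.pi * I * (-(l * pb) / k)) *
        Complex.exp (2 * Real.pi * I * (l / (p * k))) := by
  obtain ⟨N, hN⟩ := (Int.modEq_iff_dvd.mp (mul_inv_add_mul_inv_modEq_one hpk hk hp).symm)
  -- hN : k * kb + p * pb - 1 = p * k * N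
  have hp0' : (p : ℂ) ≠ 0 := by exact_mod_cast hp0
  have hk0' : (k : ℂ) ≠ 0 := by exact_mod_cast hk0
  have key : (l : ℂ) * kb / p = -(l * pb) / k + l / (p * k) + l * N := by
    have hN' : ((k : ℂ) * kb + p * pb - 1) = p * k * N := by exact_mod_cast hN
    field_simp
    linear_combination (l : ℂ) * hN'
  rw [key, mul_add, mul_add, Complex.exp_add, Complex.exp_add]
  have hper : Complex.exp (2 * Real.pi * I * (l * N)) = 1 := by
    have : 2 * (Real.pi : ℂ) * I * (l * N) = ((l * N : ℤ) : ℂ) * (2 * Real.pi * I) := by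
      push_cast; ring
    rw [this]
    exact Complex.exp_int_mul_two_pi_mul_I (l * N)
  rw [hper, mul_one]

/-! ### Composite modulus: the third display of Zhang's §7 -/

section Composite

variable {k : ℕ} [NeZero k]

/-- **Zhang's third display** [cite: Zhang2022LandauSiegel, §7, proof of Proposition 7.1, display
"For (l,k) = 1 we have e(−l p̄/k) = μ(k)/φ(k) + (1/φ(k)) Σ′_{θ (mod k)} τ(θ̄)θ(l)θ̄(−p)"]: for units
`l, p` modulo `k` (`p̄ p ≡ 1 (mod k)`; `Σ′` = the non-principal characters),
`e(−l p̄/k) = μ(k)/φ(k) + φ(k)⁻¹ ∑_{θ ≠ θ₀} τ(θ̄) θ(l) θ̄(−p)` — the expansion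
`sum_gaussSum_inv_mul_apply` at `a = −l p̄` with the principal term `τ(θ̄₀) = μ(k)` (the tree's
`Literature.NumberTheory.Sieve.MontgomeryVaughan1975.gaussSum_one_inv_eq_moebius`) split off. -/
theorem stdAddChar_neg_mul_inv_eq [DecidableEq (DirichletCharacter ℂ k)] (l p : (ZMod k)ˣ) :
    (ZMod.stdAddChar (-((l : ZMod k) * ((p⁻¹ : (ZMod k)ˣ) : ZMod k))) : ℂ) =
      (ArithmeticFunction.moebius k : ℂ) / (k.totient : ℂ) +
        (k.totient : ℂ)⁻¹ * ∑ θ ∈ (univ : Finset (DirichletCharacter ℂ k)).erase 1,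
          gaussSum θ⁻¹ (ZMod.stdAddChar (N := k)) * θ l * θ⁻¹ (-(p : ZMod k)) := by
  have hφ : (k.totient : ℂ) ≠ 0 := by
    exact_mod_cast (Nat.totient_pos.mpr (NeZero.pos k)).ne'
  -- the expansion at the unit `a = -(l p⁻¹) = l (-p)⁻¹`
  have h := sum_gaussSum_inv_mul_apply (m := k) (l * (-p)⁻¹)
  -- rewrite `θ(l (-p)⁻¹) = θ(l) θ⁻¹(-p)` inside the sum, then the argument of `e(·)`
  have hterm : ∀ θ : DirichletCharacter ℂ k,
      gaussSum θ⁻¹ (ZMod.stdAddChar (N := k)) * θ ((l * (-p)⁻¹ : (ZMod k)ˣ) : ZMod k) =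
        gaussSum θ⁻¹ (ZMod.stdAddChar (N := k)) * θ l * θ⁻¹ (-(p : ZMod k)) := by
    intro θ
    rw [Units.val_mul, map_mul, ← Units.val_neg, MulChar.inv_apply θ ((-p : (ZMod k)ˣ) : ZMod k),
      Ring.inverse_unit, mul_assoc]
  simp_rw [hterm] at h
  have hval : ((l * (-p)⁻¹ : (ZMod k)ˣ) : ZMod k) = -((l : ZMod k) * ((p⁻¹ : (ZMod k)ˣ) : ZMod k)) := by
    rw [Units.val_mul, inv_neg, Units.val_neg]; ring
  rw [hval] at h
  -- split off the principal character
  rw [← Finset.sum_erase_add _ _ (mem_univ (1 : DirichletCharacter ℂ k)),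
    Literature.NumberTheory.Sieve.MontgomeryVaughan1975.gaussSum_one_inv_eq_moebius,
    MulChar.one_apply_coe, inv_one, MulChar.one_apply p.isUnit.neg, mul_one, mul_one] at h
  -- `h : Σ' + μ k = φ(k) e(·)`; divide by `φ(k)`
  set S := ∑ θ ∈ (univ : Finset (DirichletCharacter ℂ k)).erase 1,
    gaussSum θ⁻¹ (ZMod.stdAddChar (N := k)) * θ l * θ⁻¹ (-(p : ZMod k)) with hS
  set E : ℂ := ZMod.stdAddChar (-((l : ZMod k) * ((p⁻¹ : (ZMod k)ˣ) : ZMod k))) with hE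
  calc E = E * (k.totient : ℂ) / (k.totient : ℂ) := (mul_div_cancel_right₀ E hφ).symm
    _ = (S + (ArithmeticFunction.moebius k : ℂ)) / (k.totient : ℂ) := by rw [mul_comm, ← h]
    _ = _ := by field_simp; ring

end Composite

end Literature.NumberTheory.GaussSums
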